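import Mathlib
import Literature.Analysis.FluidPDE.Tao2016AveragedNS.ShiftSetCascadeFlows
import Literature.Analysis.FluidPDE.Tao2016AveragedNS.ShiftSetCascadeFlux
import Summits.NavierStokesRegularity.NavierStokesRegularity.Theorems.TaoLadderRungTwoFlatCertificateGlueReadoutLSoundOn
import HarnessLib

/-!
# Certificate glue on a shift set `𝕊`, XXXIV-e: READOUT-L ALONG TRAJECTORIES — `StepRead` into the section-node PARALLELEPIPED (the node of glue XXX
  `sectionNode` kept as `x* + C*ξ + e*`, not collapsed to its box hull) from the step / section Booleans over a generic coefficient table, and the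
  composition with `checkReadoutL` ⇒ `StepRead` with exactly the readout property `hread` of glue XXXI (helper for items stmt-NavierStokesRegularity-22987
  `FlatGapCertificatesV2` (crux K_A♭ of route TaoLadderRungTwoFlat) and stmt-24295 K_A₂(64); cell harvest/h2-tao-ladder, p1 g17; theory-1 g29 A-77 (i)
  «stepRead_of_checksV_para»)

HONEST FRAMING: Tao-type MODEL lattices (Tao 2016 §4/§6 vocabulary, shift-set parametrised); checker soundness — NO certificate instance exists in the
tree, nothing is certified here, no stub is closed, nothing here is a statement about the Navier–Stokes equations.
-/

-- the sub-problem namespace repeats the summit name by design (D-0017)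
set_option linter.dupNamespace false

namespace Summit.NavierStokesRegularity.NavierStokesRegularity.Theorems

open Set Finset Literature.Analysis.FluidPDE Literature.Analysis.FluidPDE.TaoCascade
open Summit.NavierStokesRegularity.NavierStokesRegularity.Theorems.TaylorModelCert

namespace CertificateGlueOn

variable {m : ℕ} {Kb Ka : ℤ}

/-! ### Composition with the section step: the node KEPT as a parallelepiped -/

variable {𝕊 : Finset (ℤ × ℤ × ℤ)} {ε₀ : ℝ} {α : Fin m → Fin m → Fin m → ℤ × ℤ × ℤ → ℝ} {Eb Et : ℝ} {M : ℤ → ℝ}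

/-- **`StepRead` INTO THE SECTION-NODE PARALLELEPIPED, VECTOR REMAINDER**: glue XXXI-b `stepRead_of_sectionNodeV` stopped one step earlier — the
state read on the section lies in `x* + C*ξ + e*` with the node's own `ξ` (`|ξ| ≤ r`) and `|e*| ≤ E*` (glue XXX `sectionNode`), i.e. in
`PInParaV x* C* r E*`. [cite: Zgliczynski2002C1Lohner, §3–4 (Lohner-type parallelepiped sets; section maps); cell certificate format, section readout, vector remainder] -/
theorem stepRead_para_of_sectionNodeV (hKb : 0 ≤ Kb) (hKa : 1 ≤ Ka) {ω : Fin m → ℤ → ℝ} (hω : ∀ i k, 0 < ω i k)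
    {t : ℕ → ℝ} {Node Hull : ℕ → (Fin m → ℤ → ℝ) → Prop} {j : ℕ}
    {xb r E : Fin (m * winLen Kb Ka) → ℝ} {C : Matrix (Fin (m * winLen Kb Ka)) (Fin (m * winLen Kb Ka)) ℝ}
    {lo hi dlo dhi : Fin m → ℤ → ℝ} {q p f κ Φ W : Fin (m * winLen Kb Ka) → ℝ} {Δ lev : ℝ}
    (hstep : StepCert 𝕊 ε₀ α Kb Ka Eb Et M t Node Hull j)
    (hN : ∀ y, Node j y → PInParaV Kb Ka ω xb C r E y) (hHB : ∀ y, Hull j y → InBoxOn Kb Ka lo hi y)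
    (hrange : FieldRangeOn 𝕊 ε₀ α Kb Ka Eb Et lo hi dlo dhi) (hΔ : t (j + 1) - t j ≤ Δ)
    (hd : 0 < secD q p f) (hκ : ∀ c, |f c| ≤ κ c * secD q p f)
    (hF : ∀ c, pxcoord Kb Ka ω dlo c ≤ pxcoord Kb Ka ω dhi c)
    (hΦ : ∀ c, pxcoord Kb Ka ω dhi c - f c ≤ Φ c ∧ f c - pxcoord Kb Ka ω dlo c ≤ Φ c)
    (hW : ∀ y, InBoxOn Kb Ka lo hi y → ∀ c, |pxcoord Kb Ka ω y c - p c| ≤ W c) :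
    StepRead 𝕊 ε₀ α Kb Ka Eb Et M t Node (fun y => secQ q (pxcoord Kb Ka ω y) = lev →
      PInParaV Kb Ka ω (secCentre q p f xb lev) (secFrame q p f C) r (secErr q p κ E Φ Δ (secQmax q W)) y) j := by
  intro s S hs0 hs1 hnode hrun hM hsec
  have hKK : 0 ≤ Ka + Kb + 1 := by omega
  have hin : ∀ u ∈ Icc 0 s, InBoxOn Kb Ka lo hi (slice S u) :=
    fun u hu => hHB _ ((hstep s S hs0 hs1 hnode hrun hM).1 u hu)
  have hpl := picard_level hrun hrange hin
  obtain ⟨ξ, e, hξ, he, hx0⟩ := hN _ hnode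
  have hδ : ∀ d, s * pxcoord Kb Ka ω dlo d ≤ pxcoord Kb Ka ω (slice S s) d - pxcoord Kb Ka ω (slice S 0) d ∧
      pxcoord Kb Ka ω (slice S s) d - pxcoord Kb Ka ω (slice S 0) d ≤ s * pxcoord Kb Ka ω dhi d := by
    intro d
    obtain ⟨hk1, hk2⟩ := shellAt_mem hKK (finProdFinEquiv.symm d).2
    have h := hpl (finProdFinEquiv.symm d).1 (shellAt Kb (finProdFinEquiv.symm d).2) hk1 hk2 s ⟨hs0.le, le_rfl⟩
    have hωp := hω (finProdFinEquiv.symm d).1 (shellAt Kb (finProdFinEquiv.symm d).2)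
    simp only [pxcoord, pwcoord, slice_apply]
    rw [← sub_div, mul_div_assoc', mul_div_assoc']
    exact ⟨div_le_div_of_nonneg_right h.1 hωp.le, div_le_div_of_nonneg_right h.2 hωp.le⟩
  obtain ⟨es, hes, hz⟩ := sectionNode (E := E) hd hκ hx0 he ⟨hs0.le, hs1.trans hΔ⟩ hδ hF hΦ hsec (hW _ (hin s ⟨hs0.le, le_rfl⟩))
  exact ⟨ξ, es, hξ, hes, hz⟩

/-- **`StepRead` INTO THE SECTION-NODE PARALLELEPIPED FROM THE BOOLEANS (GENERIC TABLE)**: `checkGlobalG`, `checkStepG … j` and `checkSection` ⇒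
every run from `nodeOfV rec j` of length `≤ h j`, read where `sec_q(pxcoord y) = lev`, lies in `PInParaV x* C* r E*` (`x*`, `C*`, `E*` the section-node
centre / frame / remainder of glue XXX built from the record, `E*` from the remainder VECTOR `(rec j).E`).
[cite: Zgliczynski2002C1Lohner, §3–4 (Lohner-type parallelepiped sets; section maps); cell certificate format, section checker, vector remainder] -/
theorem stepRead_para_of_checksG (hKb : 0 ≤ Kb) (hKa : 1 ≤ Ka) {shifts : List (ℤ × ℤ × ℤ)} (hnd : shifts.Nodup)
    (h𝕊 : IsNearestNeighbourSet shifts.toFinset) {q : ℚ}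
    {αq : Fin m → Fin m → Fin m → ℤ × ℤ × ℤ → ℚ} {ωq : Fin m → ℤ → ℚ} (hω : ∀ i k, 0 < ωq i k)
    {cB : Fin m → ℤ → Fin m → Fin m → ℤ × ℤ × ℤ → IntervalD}
    (hcoef : CoefBoxOK shifts (q : ℝ) (fun i₁ i₂ i μ => (αq i₁ i₂ i μ : ℝ)) Kb Ka (fun i k => (ωq i k : ℝ)) cB)
    {prec p kexp nexp : ℕ} {Sp Sm : IntervalD} {bD : Dyad} {Eb Et lev : ℚ} {M : ℤ → ℝ} {rec : ℕ → VRec}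
    {qz : Array ℤ} {sr : SecRec} {j : ℕ}
    (hg : checkGlobalG m Kb Ka prec shifts cB q Sp Sm bD = true)
    (hs : checkStepG m Kb Ka prec p kexp nexp shifts cB αq ωq Sp Sm bD Eb Et rec j = true)
    (hsec : checkSection m Kb Ka prec shifts (cB) qz (rec j).lo (rec j).hi (rec j).δ sr = true) :
    let n := m * winLen Kb Ka
    let ω : Fin m → ℤ → ℝ := fun i k => (ωq i k : ℝ)
    StepRead shifts.toFinset (q : ℝ) (fun i₁ i₂ i μ => (αq i₁ i₂ i μ : ℝ)) Kb Ka (Eb : ℝ) (Et : ℝ) M (tOfV rec) (nodeOfV Kb Ka ωq rec)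
      (fun y => secQ (qvec (n := n) qz) (pxcoord Kb Ka ω y) = (lev : ℝ) →
        PInParaV Kb Ka ω
          (secCentre (qvec (n := n) qz) (dvec (n := n) sr.p) (dvec (n := n) sr.f) (dvec (n := n) (rec j).x) (lev : ℝ))
          (secFrame (qvec (n := n) qz) (dvec (n := n) sr.p) (dvec (n := n) sr.f) (dmat (n := n) (rec j).C))
          (dvec (n := n) (rec j).r)
          (secErr (qvec (n := n) qz) (dvec (n := n) sr.p) (dvec (n := n) sr.κ) (dvec (n := n) (rec j).E) (dvec (n := n) sr.Φ)
            ((rec j).h : ℝ) (secQmax (qvec (n := n) qz) (dvec (n := n) sr.W))) y) j := by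
  intro n ω
  have hg' := hg
  simp only [checkGlobalG, Bool.and_eq_true, decide_eq_true_eq, Dyad.ble_iff, Dyad.toReal_ofInt, Int.cast_zero] at hg'
  obtain ⟨⟨⟨⟨hSp, hSm⟩, hq⟩, -⟩, -⟩ := hg'
  have hs' := hs
  simp only [checkStepG, Bool.and_eq_true, decide_eq_true_eq, Dyad.ble_iff, Dyad.toReal_ofInt, Int.cast_zero] at hs'
  obtain ⟨⟨⟨⟨⟨⟨⟨⟨⟨⟨⟨⟨⟨⟨-, -⟩, hAA'⟩, -⟩, -⟩, -⟩, -⟩, -⟩, -⟩, -⟩, -⟩, h13⟩, -⟩, h11⟩, -⟩ := hs'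
  have hq' : 0 < 1 + (q : ℝ) := by
    have : ((-1 : ℚ) : ℝ) < (q : ℝ) := by exact_mod_cast hq
    push_cast at this; linarith
  have hω' : ∀ i k, (0 : ℝ) < ω i k := fun i k => show (0 : ℝ) < (ωq i k : ℝ) by exact_mod_cast hω i k
  have hstep := stepCert_of_checkStepG (M := M) hKb hKa hnd h𝕊 hω hcoef hg hs
  have hdef := pinputDefect_of_checkDefectT prec hnd h𝕊 hq' hω hSp hSm h11
  have hrange := fieldRangeOn_of_pqBox (Eb := (Eb : ℝ)) (Et := (Et : ℝ)) hKb hKa hω' hnd hcoef prec hdef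
  obtain ⟨hd, hκ, hF, hΦ, hW⟩ := section_hyps_of_check (prec := prec) (shifts := shifts) (coefB := cB) hKb hKa hω hsec
  exact stepRead_para_of_sectionNodeV hKb hKa hω' hstep (fun y hy => hy) (fun y hy => inBox_of_hullOfG hnd hω hAA'.le h13 hy) hrange
    (tOfV_succ_sub rec j).le hd hκ hF hΦ hW

/-- **`StepRead` WITH THE READOUT CLAUSE FROM THE BOOLEANS, READOUT-L**: `checkGlobalG`, `checkStepG … j`, `checkSection` and `checkReadoutL` on the
tabulated section-node PARALLELEPIPED (`xsArr`, `csArr`, `(rec j).r`, `esArr`) ⇒ `StepRead` with exactly the readout property `hread` of glue XXXI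
`hland_of_branchMeshes'` (`sec y := secQ q (pxcoord y)`, `w := wq`, `ε₀ := q`, `θ₀ := θn/θd`), given `InCoreBox ⊆ Core`.
[cite: Tao2016AveragedNS, §6.3–6.4 Props. 6.4–6.5 (statement shape; the readout clauses); cell certificate format, readout checker L] -/
theorem stepRead_readoutL_of_checksG (hKb : 0 ≤ Kb) (hKa : 1 ≤ Ka) {shifts : List (ℤ × ℤ × ℤ)} (hnd : shifts.Nodup)
    (h𝕊 : IsNearestNeighbourSet shifts.toFinset) {q : ℚ} (hq : 0 < 1 + (q : ℝ))
    {αq : Fin m → Fin m → Fin m → ℤ × ℤ × ℤ → ℚ} {ωq : Fin m → ℤ → ℚ} (hω : ∀ i k, 0 < ωq i k)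
    {cB : Fin m → ℤ → Fin m → Fin m → ℤ × ℤ × ℤ → IntervalD}
    (hcoef : CoefBoxOK shifts (q : ℝ) (fun i₁ i₂ i μ => (αq i₁ i₂ i μ : ℝ)) Kb Ka (fun i k => (ωq i k : ℝ)) cB)
    {prec p kexp nexp : ℕ} {Sp Sm : IntervalD} {bD : Dyad} {Eb Et lev : ℚ} {M : ℤ → ℝ} {rec : ℕ → VRec}
    {qz : Array ℤ} {sr : SecRec} {j : ℕ} {Core : (Fin m → ℤ → ℝ) → Prop}
    {i₀ : Fin m} {σ ρ r Zx Et' Cs : ℚ} {θn θd : ℕ} {wq : ℤ → ℚ} {ell cen chw : Array Dyad}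
    (hg : checkGlobalG m Kb Ka prec shifts cB q Sp Sm bD = true)
    (hs : checkStepG m Kb Ka prec p kexp nexp shifts cB αq ωq Sp Sm bD Eb Et rec j = true)
    (hsec : checkSection m Kb Ka prec shifts (cB) qz (rec j).lo (rec j).hi (rec j).δ sr = true)
    (hread : checkReadoutL m Kb Ka ωq i₀ q σ ρ r Zx Et' θn θd wq Cs ell cen chw (xsArr (m * winLen Kb Ka) qz sr (rec j).x lev)
      (csArr (m * winLen Kb Ka) qz sr (rec j).C) (rec j).r (esArr (m * winLen Kb Ka) qz sr (rec j).E (rec j).h) = true)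
    (hcoreL : ∀ z : Fin m → ℤ → ℝ, InCoreBox Kb Ka Cs cen chw z → Core z) :
    StepRead shifts.toFinset (q : ℝ) (fun i₁ i₂ i μ => (αq i₁ i₂ i μ : ℝ)) Kb Ka (Eb : ℝ) (Et : ℝ) M (tOfV rec) (nodeOfV Kb Ka ωq rec)
      (fun y => secQ (qvec (n := m * winLen Kb Ka) qz) (pxcoord Kb Ka (fun i k => (ωq i k : ℝ)) y) = (lev : ℝ) →
        ∃ (a' : ℝ) (z' : Fin m → ℤ → ℝ), 0 < a' ∧ (1 + (q : ℝ)) ^ (-((θn : ℝ) / (θd : ℝ))) ≤ a' ∧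
          (1 + (σ : ℝ)) * a' ≤ |y i₀ 1| ∧ Core z' ∧
          (∀ i k, -Kb ≤ k → k + 1 ≤ Ka → (wq k : ℝ) * |y i (1 + k) / a' - z' i k| ≤ (ρ : ℝ) * (r : ℝ)) ∧
          (∀ (i : Fin m) (v : ℝ), |v| ≤ (Et' : ℝ) → (wq Ka : ℝ) * |v / a' - z' i Ka| ≤ (ρ : ℝ) * (r : ℝ)) ∧
          (∀ i, |y i (-Kb)| ≤ a' * (Zx : ℝ))) j := by
  have hSR := stepRead_para_of_checksG (M := M) (lev := lev) hKb hKa hnd h𝕊 hω hcoef hg hs hsec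
  refine stepRead_mono hSR fun y hP hlev => ?_
  have hpara := hP hlev
  refine read_of_checkReadoutL hKb hKa hω hq hread hcoreL ?_
  have hX : (fun c : Fin (m * winLen Kb Ka) => ((xsArr (m * winLen Kb Ka) qz sr (rec j).x lev).getD c 0 : ℝ)) =
      secCentre (qvec (n := m * winLen Kb Ka) qz) (dvec (n := m * winLen Kb Ka) sr.p) (dvec (n := m * winLen Kb Ka) sr.f)
        (dvec (n := m * winLen Kb Ka) (rec j).x) (lev : ℝ) := by
    funext c; unfold xsArr; rw [getD_ofFn, cast_xsQ]
  have hC : (Matrix.of fun c col : Fin (m * winLen Kb Ka) => (qmgetD (csArr (m * winLen Kb Ka) qz sr (rec j).C) c col : ℝ)) =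
      secFrame (qvec (n := m * winLen Kb Ka) qz) (dvec (n := m * winLen Kb Ka) sr.p) (dvec (n := m * winLen Kb Ka) sr.f)
        (dmat (n := m * winLen Kb Ka) (rec j).C) := by
    ext c col; rw [Matrix.of_apply, cast_csArr]
  have hE : (fun c : Fin (m * winLen Kb Ka) => ((esArr (m * winLen Kb Ka) qz sr (rec j).E (rec j).h).getD c 0 : ℝ)) =
      secErr (qvec (n := m * winLen Kb Ka) qz) (dvec (n := m * winLen Kb Ka) sr.p) (dvec (n := m * winLen Kb Ka) sr.κ)
        (dvec (n := m * winLen Kb Ka) (rec j).E) (dvec (n := m * winLen Kb Ka) sr.Φ) ((rec j).h : ℝ)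
        (secQmax (qvec (n := m * winLen Kb Ka) qz) (dvec (n := m * winLen Kb Ka) sr.W)) := by
    funext c; rw [cast_esArr]
  have hr : (fun col : Fin (m * winLen Kb Ka) => (dgetD (rec j).r col).toReal) = dvec (n := m * winLen Kb Ka) (rec j).r := rfl
  rw [hX, hC, hE, hr]
  exact hpara

end CertificateGlueOn

end Summit.NavierStokesRegularity.NavierStokesRegularity.Theorems
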